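import Mathlib
import Summits.NavierStokesRegularity.NavierStokesRegularity.Theorems.L3TimeExponentPincerRingDatumEta
import HarnessLib.Audit
import HarnessLib

/-!
# L3TimeExponentPincer — ring datum calculus XIV: sign zones of `ω_θ/r`

Support kernel for the crux `L3CascadeJaw` (item stmt-NavierStokesRegularity-19499): the TRUE
support/sign structure of `η₀ = ω_θ/r` of the glued-dipole ring datum (`F' = s^{-5/2}G`), stated
against abstract sign hypotheses on `G'` (discharged by `…RingDatumShape`:
`deriv_shape_nonpos_of_le`, `deriv_shape_nonneg_of_ge`, `deriv_shape_eq_zero_of_ge`):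

* `angVortQuot_ringField_nonpos_of_ge` — `η₀ ≤ 0` on `|x|² ≥ 2a` (so `η₀⁺` lives in the core ball
  `|x|² ≤ 2a`, giving `m ~ κ/a`, `P ~ κ` by sup × volume, NOT the crude `closedBall √R` bound);
* `angVortQuot_ringField_nonneg_of_le` — `η₀ ≥ 0` on `|x|² ≤ b` (so `η₀⁻` lives in the shell);
* `abs_angVortQuot_ringField_le_of_ge` — `|η₀| ≤ 4 b^{-3/2} D_s` on `|x|² ≥ b` (shell sup `~ κ b^{-5/2}`);
* `angVortQuot_ringField_eq_zero_of_ge` — `η₀ = 0` on `|x|² ≥ 2b` when `G' = 0` there.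

WHAT THIS IS NOT: pure calculus; no fluid statement.
-/

namespace Summit.NavierStokesRegularity.NavierStokesRegularity.Theorems.L3TimeExponentPincerRingDatumEtaSupport

open Real Set Metric Literature.Analysis.FluidPDE
open Summit.NavierStokesRegularity.NavierStokesRegularity.Theorems.L3TimeExponentPincerRingDatumEta

variable {F G : ℝ → ℝ} {a b D : ℝ}

/-- **`η₀ ≤ 0` off the core**: if `G' ≥ 0` on `[2a, ∞)` (`a > 0`) then `η₀(x) ≤ 0` for `|x|² ≥ 2a`. -/
theorem angVortQuot_ringField_nonpos_of_ge (hF : ContDiff ℝ 4 F)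
    (hF' : deriv F = fun s => s ^ (-(5 / 2 : ℝ)) * G s) (hG : Differentiable ℝ G) (ha : 0 < a)
    (hG' : ∀ s, 2 * a ≤ s → 0 ≤ deriv G s) {x : EuclideanSpace ℝ (Fin 3)} (hx : 2 * a ≤ ‖x‖ ^ 2) :
    angVortQuot (curl fun y : EuclideanSpace ℝ (Fin 3) => F (‖y‖ ^ 2) • rotGen y) x ≤ 0 := by
  have hx0 : x ≠ 0 := by
    intro h0; rw [h0, norm_zero] at hx; norm_num at hx; linarith
  exact angVortQuot_ringField_nonpos hF hF' hG hx0 (hG' _ hx)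

/-- **`η₀ ≥ 0` in the core side**: if `G' ≤ 0` on `(−∞, b]` and `G = 0` on `(−∞, a]` (`a > 0`) then
`η₀(x) ≥ 0` for `|x|² ≤ b`. -/
theorem angVortQuot_ringField_nonneg_of_le (hF : ContDiff ℝ 4 F)
    (hF' : deriv F = fun s => s ^ (-(5 / 2 : ℝ)) * G s) (hG : Differentiable ℝ G) (ha : 0 < a)
    (hGa : ∀ s, s ≤ a → G s = 0) (hG' : ∀ s, s ≤ b → deriv G s ≤ 0)
    {x : EuclideanSpace ℝ (Fin 3)} (hx : ‖x‖ ^ 2 ≤ b) :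
    0 ≤ angVortQuot (curl fun y : EuclideanSpace ℝ (Fin 3) => F (‖y‖ ^ 2) • rotGen y) x := by
  by_cases hx0 : x = 0
  · rw [angVortQuot_ringField_eq_zero hF hF' hGa (by rw [hx0, norm_zero]; simpa using ha)]
  · exact angVortQuot_ringField_nonneg hF hF' hG hx0 (hG' _ hx)

/-- **Shell sup bound**: if `|G'| ≤ D` on `[b, ∞)` (`b > 0`) then `|η₀(x)| ≤ 4 b^{-3/2} D` for
`|x|² ≥ b`. -/
theorem abs_angVortQuot_ringField_le_of_ge (hF : ContDiff ℝ 4 F)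
    (hF' : deriv F = fun s => s ^ (-(5 / 2 : ℝ)) * G s) (hG : Differentiable ℝ G) (hb : 0 < b)
    (hD : ∀ s, b ≤ s → |deriv G s| ≤ D) {x : EuclideanSpace ℝ (Fin 3)} (hx : b ≤ ‖x‖ ^ 2) :
    |angVortQuot (curl fun y : EuclideanSpace ℝ (Fin 3) => F (‖y‖ ^ 2) • rotGen y) x| ≤
      4 * b ^ (-(3 / 2 : ℝ)) * D := by
  have hx0 : x ≠ 0 := by
    intro h0; rw [h0, norm_zero] at hx; norm_num at hx; linarith
  have hD0 : 0 ≤ D := (abs_nonneg _).trans (hD _ hx)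
  rw [angVortQuot_ringField_eq hF hF' hG hx0, abs_neg, abs_mul, abs_mul,
    abs_of_nonneg (by norm_num : (0 : ℝ) ≤ 4), abs_of_nonneg (Real.rpow_nonneg (sq_nonneg _) _)]
  have h1 : (‖x‖ ^ 2) ^ (-(3 / 2 : ℝ)) ≤ b ^ (-(3 / 2 : ℝ)) :=
    Real.rpow_le_rpow_of_nonpos hb hx (by norm_num)
  have h2 : 0 ≤ (‖x‖ ^ 2) ^ (-(3 / 2 : ℝ)) := Real.rpow_nonneg (sq_nonneg _) _
  calc 4 * (‖x‖ ^ 2) ^ (-(3 / 2 : ℝ)) * |deriv G (‖x‖ ^ 2)|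
      ≤ 4 * b ^ (-(3 / 2 : ℝ)) * D := by
        gcongr
        exact hD _ hx

/-- **`η₀ = 0` beyond the shell**: if `G' = 0` on `[2b, ∞)` (`b > 0`) then `η₀(x) = 0` for
`|x|² ≥ 2b`. -/
theorem angVortQuot_ringField_eq_zero_of_ge (hF : ContDiff ℝ 4 F)
    (hF' : deriv F = fun s => s ^ (-(5 / 2 : ℝ)) * G s) (hG : Differentiable ℝ G) (hb : 0 < b)
    (hG0 : ∀ s, 2 * b ≤ s → deriv G s = 0) {x : EuclideanSpace ℝ (Fin 3)} (hx : 2 * b ≤ ‖x‖ ^ 2) :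
    angVortQuot (curl fun y : EuclideanSpace ℝ (Fin 3) => F (‖y‖ ^ 2) • rotGen y) x = 0 := by
  have hx0 : x ≠ 0 := by
    intro h0; rw [h0, norm_zero] at hx; norm_num at hx; linarith
  rw [angVortQuot_ringField_eq hF hF' hG hx0, hG0 _ hx, mul_zero, neg_zero]

/-- **`η₀ = 0` in the dipole gap**: if `G' = 0` on `[2a, b]` (`a > 0`) then `η₀(x) = 0` for
`2a ≤ |x|² ≤ b`. -/
theorem angVortQuot_ringField_eq_zero_of_mem (hF : ContDiff ℝ 4 F)
    (hF' : deriv F = fun s => s ^ (-(5 / 2 : ℝ)) * G s) (hG : Differentiable ℝ G) (ha : 0 < a)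
    (hG0 : ∀ s ∈ Icc (2 * a) b, deriv G s = 0) {x : EuclideanSpace ℝ (Fin 3)}
    (hx : ‖x‖ ^ 2 ∈ Icc (2 * a) b) :
    angVortQuot (curl fun y : EuclideanSpace ℝ (Fin 3) => F (‖y‖ ^ 2) • rotGen y) x = 0 := by
  have hx0 : x ≠ 0 := by
    intro h0; rw [h0, norm_zero] at hx; norm_num at hx; linarith [hx.1]
  rw [angVortQuot_ringField_eq hF hF' hG hx0, hG0 _ hx, mul_zero, neg_zero]

end Summit.NavierStokesRegularity.NavierStokesRegularity.Theorems.L3TimeExponentPincerRingDatumEtaSupport
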